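import Literature.Probability.RandomPlanarGeometry.SLE
import Literature.Probability.RandomPlanarGeometry.SLEExistenceConverse
import Literature.Probability.RandomPlanarGeometry.CritPercSLE
import Literature.Probability.RandomPlanarGeometry.CurveSpace
import HarnessLib

/-!
# `stub_kappaPinGlue`: the κ-pin for SLE laws at a flat wall point, from the half-plane pin and
# the flat-window transport (measure bookkeeping)

Stub S6c `stub_kappaPinGlue` of the registered skeleton of the line `boundary-area-law` for the
crux `SubseqIdentification` (stmt-CriticalPhenomena-0783, route `SAWRenewalTightness`; primary
decl `SAWParafermion.SubseqIdentification`, identical shared decl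
`SAWRenewalTightness.SubseqIdentification`).

The statement is an implication `S6a → S6b → S6`:
* S6a (first hypothesis, the neighbour stub `stub_kappaPinHalfPlane`): for `κ > 0` with
  `HasSLETrace κ` and a real point `u₀ ≠ 0`, the SLE_κ trace in `ℍ` satisfies (i) non-degeneracy
  `P[dist(u₀, γ[0,∞)) < ρ] > 0` and (ii) a two-sided `ρ²` law for `dist(u₀, γ[0,∞))` forces
  `κ = 8/3`;
* S6b (second hypothesis, the neighbour stub `stub_windowTransport`): for a Dobrushin domain with
  a flat horizontal window at `x₀ ∉ {a, b}` and a chordal uniformizing map `φ`, the boundary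
  extension `Φ` of `φ` is two-sidedly Lipschitz at one real point `u₀ ≠ 0` relative to the closed
  half-plane, with `Φ(u₀) = x₀` in the quantitative sense displayed;
* S6 (conclusion, the derived stub `stub_kappaPin`): for an SLE_κ law `μ` of such a domain,
  (i) `μ[dist(x₀, trace) < ε] > 0` for all `ε > 0` and (ii) a two-sided `r²` law for
  `dist(x₀, trace)` under `μ` forces `κ = 8/3`.

Proof (pure bookkeeping). Unfold `IsSLELaw κ D μ` to `μ = P.map Γ` with, almost surely,
`Γ ω = CurveClass.mk c_ω` and `c_ω` the time-compactified image of `sleTrace κ ω` under `Φ`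
ending at `b = D.pt 1` (`IsSLECurve`, `IsCompactifiedImage`); the trace theorem `HasSLETrace κ`
needed by S6a is `IsSLELaw.hasSLETrace`. Deterministically, for such `c` (the trace lies in the
closed half-plane, `sleTrace_im_nonneg`): if `dist(u₀, range γ) < ρ ≤ η` then
`dist(x₀, range c) < L ρ` (a trace point `ρ`-close to `u₀` is mapped `Lρ`-close to `x₀`, and its
image is a point of `c`, `exists_rayParam_eq`), and if `dist(x₀, range c) < r ≤ min(η, |x₀ - b|)`
then `dist(u₀, range γ) < L r` (a point of `c` that is `r`-close to `x₀` is not the endpoint `b`,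
hence is `Φ(γ t)`); the non-strict versions follow by approximation. The events
`{dist(x₀, ·.range) ≤ r}` / `{… < r}` are closed / open in `CurveClass ℂ` because
`c ↦ infDist x₀ c.range` is `1`-Lipschitz (`Curve.infDist_range_le`), so
`μ S = P (Γ ⁻¹' S)` (`Measure.map_apply_of_aemeasurable`) resp. `P (Γ ⁻¹' S) ≤ μ S`
(`Measure.le_map_apply`), and almost sure inclusions give inequalities of measures
(`measure_mono_ae`). With these, (i) follows from S6a (i) at radius `min(ε/L, η)`, and a two-sided
`r²` law for `μ` with constants `(c, C, r₀)` gives one for the trace at `u₀` with constants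
`(c/L², C L², ρ₀')`, `ρ₀' = min(η, r₀/L, L·min(η, |x₀ - b|, r₀))`, so S6a (ii) pins `κ = 8/3`.

No named fact is used beyond the two displayed hypotheses.
-/

open MeasureTheory Filter Topology Set
open scoped NNReal ENNReal

namespace Summit.CriticalPhenomena.SAWScalingLimit.Theorems.SubseqIdentification.BoundaryAreaLaw

open Literature.Probability.RandomPlanarGeometry
open Literature.Probability.Process (preWienerMeasure)
open UpperHalfPlane (upperHalfPlaneSet)

/-! ## The distance to the trace is a Lipschitz functional on curve classes -/

/-- For two parametrised curves, the distance from a point to the trace of the first is at most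
the distance to the trace of the second plus the reparametrisation distance of the curves
(every point of `γ₂` is within `dist γ₁ γ₂` of the trace of `γ₁`, `Curve.infDist_range_le`).
[folklore] -/
private theorem infDist_range_le_infDist_range_add (x : ℂ) (γ₁ γ₂ : Curve ℂ) :
    Metric.infDist x γ₁.range ≤ Metric.infDist x γ₂.range + dist γ₁ γ₂ := by
  refine le_of_forall_pos_lt_add fun ε hε => ?_
  obtain ⟨y, hy, hxy⟩ := (Metric.infDist_lt_iff γ₂.range_nonempty).1
    (show Metric.infDist x γ₂.range < Metric.infDist x γ₂.range + ε / 2 by linarith)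
  obtain ⟨t, rfl⟩ := Curve.mem_range.1 hy
  have ht : Metric.infDist (γ₂ t) γ₁.range < dist γ₁ γ₂ + ε / 2 :=
    (Curve.infDist_range_le γ₂ γ₁ t).trans_lt (by rw [dist_comm γ₂ γ₁]; linarith)
  obtain ⟨z, hz, htz⟩ := (Metric.infDist_lt_iff γ₁.range_nonempty).1 ht
  calc Metric.infDist x γ₁.range ≤ dist x z := Metric.infDist_le_dist_of_mem hz
    _ ≤ dist x (γ₂ t) + dist (γ₂ t) z := dist_triangle _ _ _
    _ < Metric.infDist x γ₂.range + dist γ₁ γ₂ + ε := by linarith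

/-- The distance from a fixed point `x` to the trace, `c ↦ infDist x c.range`, is a `1`-Lipschitz
functional on the space `CurveClass ℂ` of curves modulo reparametrisation (pattern of
`CurveClass.lipschitzWith_source`). [folklore] -/
private theorem lipschitzWith_infDist_range (x : ℂ) :
    LipschitzWith 1 (fun c : CurveClass ℂ => Metric.infDist x c.range) :=
  LipschitzWith.mk_one fun c₁ c₂ => by
    obtain ⟨γ₁, rfl⟩ := CurveClass.surjective_mk c₁
    obtain ⟨γ₂, rfl⟩ := CurveClass.surjective_mk c₂
    simp only [CurveClass.dist_mk_mk, CurveClass.range_mk]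
    rw [Real.dist_eq, abs_sub_le_iff]
    have h₁ := infDist_range_le_infDist_range_add x γ₁ γ₂
    have h₂ := infDist_range_le_infDist_range_add x γ₂ γ₁
    rw [dist_comm γ₂ γ₁] at h₂
    constructor <;> linarith

/-- The event "the trace comes within distance `≤ r` of `x`" is a Borel set of `CurveClass ℂ`
(a closed set, sublevel set of a continuous functional). [folklore] -/
private theorem measurableSet_infDist_range_le (x : ℂ) (r : ℝ) :
    MeasurableSet {c : CurveClass ℂ | Metric.infDist x c.range ≤ r} :=
  (isClosed_le (lipschitzWith_infDist_range x).continuous continuous_const).measurableSet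

/-! ## Deterministic transport through the compactified image -/

/-- Approximation step: if `a < ρ'` forces `d < L ρ'` for every level `ρ' ≤ η`, then `a ≤ ρ`
with `ρ < η` forces `d ≤ L ρ` (`L > 0`). [folklore] -/
private theorem le_mul_of_forall_lt {a d L η ρ : ℝ} (hL : 0 < L) (hρ : ρ < η)
    (h : ∀ ρ' : ℝ, ρ' ≤ η → a < ρ' → d < L * ρ') (ha : a ≤ ρ) : d ≤ L * ρ := by
  refine le_of_forall_pos_lt_add fun ε hε => ?_
  have hlt : ρ < min (ρ + ε / L) η := lt_min (lt_add_of_pos_right ρ (div_pos hε hL)) hρ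
  calc d < L * min (ρ + ε / L) η := h _ (min_le_right _ _) (ha.trans_lt hlt)
    _ ≤ L * (ρ + ε / L) := by gcongr; exact min_le_left _ _
    _ = L * ρ + ε := by rw [mul_add, mul_div_cancel₀ _ hL.ne']

section Transport

variable {Φ : ℂ → ℂ} {γ : ℝ≥0 → ℂ} {b x₀ : ℂ} {c : Curve ℂ} {u₀ L η : ℝ}

/-- **Transport `ℍ → D`, strict form.** If the half-plane curve `γ` (in the closed half-plane)
comes within distance `< ρ ≤ η` of `u₀`, then its compactified image `c` under `Φ` comes within
distance `< L ρ` of `x₀`, by the Lipschitz bound of `Φ` at `u₀`. [folklore] -/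
private theorem infDist_image_lt (hc : IsCompactifiedImage Φ γ b c) (him : ∀ t, 0 ≤ (γ t).im)
    (hL : 0 < L)
    (hLip : ∀ u : ℂ, 0 ≤ u.im →
      (dist u (u₀ : ℂ) < η → dist (Φ u) x₀ ≤ L * dist u (u₀ : ℂ)) ∧
        (dist (Φ u) x₀ < η → dist u (u₀ : ℂ) ≤ L * dist (Φ u) x₀))
    {ρ : ℝ} (hρ : ρ ≤ η) (h : Metric.infDist (u₀ : ℂ) (Set.range γ) < ρ) :
    Metric.infDist x₀ c.range < L * ρ := by
  obtain ⟨y, hy, hty⟩ := (Metric.infDist_lt_iff (Set.range_nonempty γ)).1 h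
  obtain ⟨t, rfl⟩ := Set.mem_range.1 hy
  rw [dist_comm] at hty
  obtain ⟨s, hs, hst⟩ := exists_rayParam_eq t
  have hmem : Φ (γ t) ∈ c.range := Curve.mem_range.2 ⟨s, by rw [hc.1 s hs, hst]⟩
  calc Metric.infDist x₀ c.range ≤ dist x₀ (Φ (γ t)) := Metric.infDist_le_dist_of_mem hmem
    _ = dist (Φ (γ t)) x₀ := dist_comm _ _
    _ ≤ L * dist (γ t) (u₀ : ℂ) := (hLip (γ t) (him t)).1 (hty.trans_le hρ)
    _ < L * ρ := by gcongr

/-- **Transport `D → ℍ`, strict form.** If the compactified image `c` comes within distance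
`< r` of `x₀`, where `r ≤ η` and `r ≤ dist x₀ b`, then the witnessing point of `c` is not the
endpoint `b`, hence is `Φ (γ t)` for some `t`, and `γ` comes within distance `< L r` of `u₀` by
the reverse Lipschitz bound. [folklore] -/
private theorem infDist_range_lt (hc : IsCompactifiedImage Φ γ b c) (him : ∀ t, 0 ≤ (γ t).im)
    (hL : 0 < L)
    (hLip : ∀ u : ℂ, 0 ≤ u.im →
      (dist u (u₀ : ℂ) < η → dist (Φ u) x₀ ≤ L * dist u (u₀ : ℂ)) ∧
        (dist (Φ u) x₀ < η → dist u (u₀ : ℂ) ≤ L * dist (Φ u) x₀))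
    {r : ℝ} (hr : r ≤ η) (hrb : r ≤ dist x₀ b) (h : Metric.infDist x₀ c.range < r) :
    Metric.infDist (u₀ : ℂ) (Set.range γ) < L * r := by
  obtain ⟨y, hy, hsy⟩ := (Metric.infDist_lt_iff c.range_nonempty).1 h
  obtain ⟨s, rfl⟩ := Curve.mem_range.1 hy
  rcases (unitInterval.le_one s).lt_or_eq with hs1 | hs1
  · rw [hc.1 s hs1, dist_comm] at hsy
    calc Metric.infDist (u₀ : ℂ) (Set.range γ) ≤ dist (u₀ : ℂ) (γ (rayParam s)) :=
          Metric.infDist_le_dist_of_mem (Set.mem_range_self _)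
      _ = dist (γ (rayParam s)) (u₀ : ℂ) := dist_comm _ _
      _ ≤ L * dist (Φ (γ (rayParam s))) x₀ := (hLip _ (him _)).2 (hsy.trans_le hr)
      _ < L * r := by gcongr
  · rw [Set.Icc.coe_eq_one.1 hs1, hc.2] at hsy
    exact absurd (hsy.trans_le hrb) (lt_irrefl _)

/-- **Transport `ℍ → D`, non-strict form**: `dist(u₀, range γ) ≤ ρ < η` gives
`dist(x₀, range c) ≤ L ρ`. [folklore] -/
private theorem infDist_image_le (hc : IsCompactifiedImage Φ γ b c) (him : ∀ t, 0 ≤ (γ t).im)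
    (hL : 0 < L)
    (hLip : ∀ u : ℂ, 0 ≤ u.im →
      (dist u (u₀ : ℂ) < η → dist (Φ u) x₀ ≤ L * dist u (u₀ : ℂ)) ∧
        (dist (Φ u) x₀ < η → dist u (u₀ : ℂ) ≤ L * dist (Φ u) x₀))
    {ρ : ℝ} (hρ : ρ < η) (h : Metric.infDist (u₀ : ℂ) (Set.range γ) ≤ ρ) :
    Metric.infDist x₀ c.range ≤ L * ρ :=
  le_mul_of_forall_lt hL hρ (fun _ hρ' h' => infDist_image_lt hc him hL hLip hρ' h') h

/-- **Transport `D → ℍ`, non-strict form**: `dist(x₀, range c) ≤ r` with `r < η` and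
`r < dist x₀ b` gives `dist(u₀, range γ) ≤ L r`. [folklore] -/
private theorem infDist_range_le_mul (hc : IsCompactifiedImage Φ γ b c)
    (him : ∀ t, 0 ≤ (γ t).im) (hL : 0 < L)
    (hLip : ∀ u : ℂ, 0 ≤ u.im →
      (dist u (u₀ : ℂ) < η → dist (Φ u) x₀ ≤ L * dist u (u₀ : ℂ)) ∧
        (dist (Φ u) x₀ < η → dist u (u₀ : ℂ) ≤ L * dist (Φ u) x₀))
    {r : ℝ} (hr : r < η) (hrb : r < dist x₀ b) (h : Metric.infDist x₀ c.range ≤ r) :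
    Metric.infDist (u₀ : ℂ) (Set.range γ) ≤ L * r :=
  le_mul_of_forall_lt hL (lt_min hr hrb)
    (fun _ hr' h' => infDist_range_lt hc him hL hLip (hr'.trans (min_le_left _ _))
      (hr'.trans (min_le_right _ _)) h') h

end Transport

/-! ## The glue -/

/-- **S6c — the glue `S6a → S6b → S6` of the line `boundary-area-law`** (crux
`SubseqIdentification`, stmt-CriticalPhenomena-0783). From the half-plane κ-pin at a real point
`u₀ ≠ 0` (first hypothesis: non-degeneracy of, and the pin by a two-sided `ρ²` law for, the
distance of the SLE_κ trace to `u₀`) and the flat-window transport (second hypothesis: the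
boundary extension of a chordal uniformizing map of a Dobrushin domain with a flat horizontal
window at `x₀ ∉ {a, b}` is two-sidedly Lipschitz at some real `u₀ ≠ 0` over `x₀`), every SLE_κ law
`μ` (`κ > 0`) of such a domain satisfies: (i) `μ[dist(x₀, trace) < ε] > 0` for every `ε > 0`, and
(ii) a two-sided law `c r² ≤ μ[dist ≤ r]`, `μ[dist < r] ≤ C r²` for small `r` forces `κ = 8/3`.
Proof: `μ = P.map Γ` with a.s. `Γ ω` the class of the compactified image of `sleTrace κ ω`
(`IsSLELaw`, `IsSLECurve`, `IsCompactifiedImage`, `IsSLELaw.hasSLETrace`); the events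
`{dist(x₀, ·.range) ≤ r}` are closed (the functional is `1`-Lipschitz), the a.s. transport of
distances (`infDist_image_lt`, `infDist_range_le_mul`) sandwiches the `D`-events between
`ℍ`-events up to null sets, and `Measure.map_apply_of_aemeasurable` / `Measure.le_map_apply` /
`measure_mono_ae` move the `r²` law to `u₀` with constants `c/L²`, `C L²`. [folklore] -/
theorem stub_kappaPinGlue :
    (∀ (κ : ℝ≥0), 0 < κ → HasSLETrace κ → ∀ (u₀ : ℝ), u₀ ≠ 0 →
      (∀ ρ : ℝ, 0 < ρ →
          0 < preWienerMeasure {ω | Metric.infDist (u₀ : ℂ) (Set.range (sleTrace κ ω)) < ρ}) ∧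
        ((∃ c C ρ₀ : ℝ, 0 < c ∧ 0 < ρ₀ ∧ ∀ ρ ∈ Set.Ioo (0 : ℝ) ρ₀,
            ENNReal.ofReal (c * ρ ^ 2) ≤
                preWienerMeasure {ω | Metric.infDist (u₀ : ℂ) (Set.range (sleTrace κ ω)) ≤ ρ} ∧
              preWienerMeasure {ω | Metric.infDist (u₀ : ℂ) (Set.range (sleTrace κ ω)) < ρ} ≤
                ENNReal.ofReal (C * ρ ^ 2)) →
          κ = 8 / 3)) →
    (∀ (D : DobrushinDomain) (x₀ : ℂ) (ρ₀ : ℝ), 0 < ρ₀ →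
      D.carrier ∩ Metric.ball x₀ ρ₀ = {z : ℂ | x₀.im < z.im} ∩ Metric.ball x₀ ρ₀ →
      x₀ ≠ D.pt 0 → x₀ ≠ D.pt 1 →
      ∀ (φ : ConformalEquiv upperHalfPlaneSet D.carrier), D.IsChordalUniformizing φ →
        ∃ u₀ L η : ℝ, u₀ ≠ 0 ∧ 0 < L ∧ 0 < η ∧
          ∀ u : ℂ, 0 ≤ u.im →
            (dist u (u₀ : ℂ) < η →
                dist (φ.boundaryExtension u) x₀ ≤ L * dist u (u₀ : ℂ)) ∧
            (dist (φ.boundaryExtension u) x₀ < η →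
                dist u (u₀ : ℂ) ≤ L * dist (φ.boundaryExtension u) x₀)) →
    ∀ (κ : ℝ≥0) (D : DobrushinDomain) (μ : Measure (CurveClass ℂ)) (x₀ : ℂ) (ρ₀ : ℝ),
      0 < κ → IsSLELaw κ D μ → 0 < ρ₀ →
      D.carrier ∩ Metric.ball x₀ ρ₀ = {z : ℂ | x₀.im < z.im} ∩ Metric.ball x₀ ρ₀ →
      x₀ ≠ D.pt 0 → x₀ ≠ D.pt 1 →
      (∀ ε : ℝ, 0 < ε → 0 < μ {γ | Metric.infDist x₀ γ.range < ε}) ∧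
        ((∃ c C r₀ : ℝ, 0 < c ∧ 0 < r₀ ∧ ∀ r ∈ Set.Ioo (0 : ℝ) r₀,
            ENNReal.ofReal (c * r ^ 2) ≤ μ {γ | Metric.infDist x₀ γ.range ≤ r} ∧
              μ {γ | Metric.infDist x₀ γ.range < r} ≤ ENNReal.ofReal (C * r ^ 2)) →
          κ = 8 / 3) := by
  intro hpin htr κ D μ x₀ ρ₀ hκ hμ hρ₀ hwin hx0 hx1
  have hT : HasSLETrace κ := hμ.hasSLETrace
  obtain ⟨Γ, ⟨hΓ, φ, hφ, hae⟩, rfl⟩ := hμ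
  obtain ⟨u₀, L, η, hu₀, hL, hη, hLip⟩ := htr D x₀ ρ₀ hρ₀ hwin hx0 hx1 φ hφ
  obtain ⟨hnd, hpinκ⟩ := hpin κ hκ hT u₀ hu₀
  have hb : 0 < dist x₀ (D.pt 1) := dist_pos.2 hx1
  -- the almost sure transport of distances between the trace in `ℍ` and the curve in `D`
  have hgood : ∀ᵐ ω ∂preWienerMeasure,
      (∀ ρ : ℝ, ρ ≤ η → Metric.infDist (u₀ : ℂ) (Set.range (sleTrace κ ω)) < ρ →
          Metric.infDist x₀ (Γ ω).range < L * ρ) ∧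
        ∀ r : ℝ, r < η → r < dist x₀ (D.pt 1) → Metric.infDist x₀ (Γ ω).range ≤ r →
          Metric.infDist (u₀ : ℂ) (Set.range (sleTrace κ ω)) ≤ L * r := by
    filter_upwards [hae] with ω hω
    obtain ⟨-, c, hΓω, hc⟩ := hω
    rw [hΓω, CurveClass.range_mk]
    exact ⟨fun ρ hρ h => infDist_image_lt hc (sleTrace_im_nonneg κ ω) hL hLip hρ h,
      fun r hr hrb h => infDist_range_le_mul hc (sleTrace_im_nonneg κ ω) hL hLip hr hrb h⟩
  refine ⟨fun ε hε => ?_, fun hlaw => hpinκ ?_⟩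
  · -- (i) non-degeneracy, from the half-plane non-degeneracy at radius `min (ε / L) η`
    have hρ : 0 < min (ε / L) η := lt_min (div_pos hε hL) hη
    calc (0 : ℝ≥0∞)
        < preWienerMeasure
            {ω | Metric.infDist (u₀ : ℂ) (Set.range (sleTrace κ ω)) < min (ε / L) η} := hnd _ hρ
      _ ≤ preWienerMeasure (Γ ⁻¹' {γ | Metric.infDist x₀ γ.range < ε}) := by
          refine measure_mono_ae ?_
          filter_upwards [hgood] with ω hω hlt
          show Metric.infDist x₀ (Γ ω).range < ε
          calc Metric.infDist x₀ (Γ ω).range < L * min (ε / L) η :=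
                hω.1 _ (min_le_right _ _) hlt
            _ ≤ L * (ε / L) := by gcongr; exact min_le_left _ _
            _ = ε := mul_div_cancel₀ _ hL.ne'
      _ ≤ preWienerMeasure.map Γ {γ | Metric.infDist x₀ γ.range < ε} :=
          Measure.le_map_apply hΓ _
  · -- (ii) the two-sided `r²` law of `μ` at `x₀` gives one for the trace at `u₀`
    obtain ⟨c, C, r₀, hc, hr₀, hlaw⟩ := hlaw
    refine ⟨c / L ^ 2, C * L ^ 2,
      min (min η (r₀ / L)) (L * min (min η (dist x₀ (D.pt 1))) r₀),
      div_pos hc (pow_pos hL 2),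
      lt_min (lt_min hη (div_pos hr₀ hL)) (mul_pos hL (lt_min (lt_min hη hb) hr₀)),
      fun ρ hρ => ?_⟩
    obtain ⟨hρ0, hρ1⟩ := hρ
    have hρη : ρ < η := (hρ1.trans_le (min_le_left _ _)).trans_le (min_le_left _ _)
    have hLρ : L * ρ < r₀ :=
      (lt_div_iff₀' hL).1 ((hρ1.trans_le (min_le_left _ _)).trans_le (min_le_right _ _))
    have hρL : ρ / L < min (min η (dist x₀ (D.pt 1))) r₀ :=
      (div_lt_iff₀' hL).2 (hρ1.trans_le (min_le_right _ _))
    constructor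
    · -- lower bound: `c (ρ/L)² ≤ μ[dist ≤ ρ/L] = P[Γ ∈ {dist ≤ ρ/L}] ≤ P[dist_ℍ ≤ ρ]`
      have hr : ρ / L ∈ Set.Ioo 0 r₀ := ⟨div_pos hρ0 hL, hρL.trans_le (min_le_right _ _)⟩
      have hrη : ρ / L < η := (hρL.trans_le (min_le_left _ _)).trans_le (min_le_left _ _)
      have hrd : ρ / L < dist x₀ (D.pt 1) :=
        (hρL.trans_le (min_le_left _ _)).trans_le (min_le_right _ _)
      calc ENNReal.ofReal (c / L ^ 2 * ρ ^ 2) = ENNReal.ofReal (c * (ρ / L) ^ 2) := by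
            congr 1; rw [div_pow]; ring
        _ ≤ preWienerMeasure.map Γ {γ | Metric.infDist x₀ γ.range ≤ ρ / L} := (hlaw _ hr).1
        _ = preWienerMeasure (Γ ⁻¹' {γ | Metric.infDist x₀ γ.range ≤ ρ / L}) :=
            Measure.map_apply_of_aemeasurable hΓ (measurableSet_infDist_range_le x₀ _)
        _ ≤ preWienerMeasure {ω | Metric.infDist (u₀ : ℂ) (Set.range (sleTrace κ ω)) ≤ ρ} := by
            refine measure_mono_ae ?_
            filter_upwards [hgood] with ω hω hle
            show Metric.infDist (u₀ : ℂ) (Set.range (sleTrace κ ω)) ≤ ρ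
            calc Metric.infDist (u₀ : ℂ) (Set.range (sleTrace κ ω)) ≤ L * (ρ / L) :=
                  hω.2 _ hrη hrd hle
              _ = ρ := mul_div_cancel₀ _ hL.ne'
    · -- upper bound: `P[dist_ℍ < ρ] ≤ P[Γ ∈ {dist < Lρ}] ≤ μ[dist < Lρ] ≤ C (Lρ)²`
      have hLρ' : L * ρ ∈ Set.Ioo 0 r₀ := ⟨mul_pos hL hρ0, hLρ⟩
      calc preWienerMeasure {ω | Metric.infDist (u₀ : ℂ) (Set.range (sleTrace κ ω)) < ρ}
          ≤ preWienerMeasure (Γ ⁻¹' {γ | Metric.infDist x₀ γ.range < L * ρ}) := by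
            refine measure_mono_ae ?_
            filter_upwards [hgood] with ω hω hlt
            exact hω.1 _ hρη.le hlt
        _ ≤ preWienerMeasure.map Γ {γ | Metric.infDist x₀ γ.range < L * ρ} :=
            Measure.le_map_apply hΓ _
        _ ≤ ENNReal.ofReal (C * (L * ρ) ^ 2) := (hlaw _ hLρ').2
        _ = ENNReal.ofReal (C * L ^ 2 * ρ ^ 2) := by
            congr 1; ring

end Summit.CriticalPhenomena.SAWScalingLimit.Theorems.SubseqIdentification.BoundaryAreaLaw
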